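import Literature.AlgebraicGeometry.Frobenioids.UnitLinearFrobenius
import Literature.AlgebraicGeometry.Frobenioids.ElementaryPreFrobenioid
import Literature.AlgebraicGeometry.Frobenioids.MonoidTransport
import Mathlib.CategoryTheory.IsConnected
import HarnessLib

/-!
# Frobenioids I, Proposition 2.5 (iii), bracket "`C(d)` is a Frobenioid": transport along `Ψ`, part 1

Mochizuki, *The geometry of Frobenioids I: the general theory*, Kyushu J. Math. **62** (2008)
293–400, §2, Proposition 2.5 (iii), kurims text p. 49 [cite: MochizukiFrdI2008, Prop. 2.5(iii) p.49]:
"(b) `Ψ` is 1-compatible, relative to the functors `C → F_Φ`, `C(d) → F_{d·Φ} = (F_Φ)(d) ⊆ F_Φ` with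
the Frobenius functor associated to `d` on `F_Φ` [which implies, in particular, that `C(d)`,
equipped with the natural functor `C(d) → F_{d·Φ}`, is a Frobenioid]."

The bracket is a TRANSPORT OF STRUCTURE along the unit-linear Frobenius functor `Ψ : C ⥲ C(d)`
(`UnitLinearFrobenius.lean`): `Ψ` is the identity on objects, bijective on arrows, and
`C(d) → F_{d·Φ}` sends `Ψ(φ)` to `(Base φ, d · Div φ, deg_Fr φ)`, where `d · (−) : Φ ⥲ d · Φ` is an
isomorphism of monoids on `D` when it is injective ("`Λ` supports `Φ`").  This file proves, for an
endomorphism `δ` of `Φ` injective on each `Φ(A)`: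
* `d · Φ` is a divisorial monoid on `D` and `C(d) → F_{d·Φ}` is a pre-Frobenioid
  (`isPreFrobenioid_cd`);
* the dictionary `Ψ(φ)` linear / isometric / base-isomorphism / pre-step / isomorphism /
  monomorphism / pull-back morphism / co-angular / of Frobenius type / co-angular pre-step in
  `C(d)` iff `φ` is so in `C`.
Part 2 (`CdIsFrobenioid.lean`) transports the objects' notions and the clauses of Def. 1.3.
-/

noncomputable section

namespace Literature.AlgebraicGeometry.Frobenioids

open CategoryTheory Opposite

universe w v v' u u'

variable {D : Type u} [Category.{v} D] {Φ : Dᵒᵖ ⥤ CommMonCat.{w}}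

/-! ### The monoid `d · Φ` for injective `δ` -/

/-- Pull-backs of `d · Φ` are the restrictions of those of `Φ`. [cite: MochizukiFrdI2008, Def. 2.4(iii) p.48] -/
theorem coe_pull_imageMonoid (δ : Φ ⟶ Φ) {A B : D} (f : B ⟶ A) (y : (imageMonoid δ).obj (op A)) :
    (pull (imageMonoid δ) f y).1 = pull Φ f y.1 := rfl

/-- For `δ` injective, `δ_A : Φ(A) ⥲ d · Φ(A)` is an isomorphism of monoids.
[cite: MochizukiFrdI2008, Def. 2.4(iii) p.48] -/
def imageEquiv (δ : Φ ⟶ Φ) (hδ : ∀ A : Dᵒᵖ, Function.Injective (δ.app A).hom) (A : Dᵒᵖ) :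
    Φ.obj A ≃* (imageMonoid δ).obj A :=
  MulEquiv.ofBijective (δ.app A).hom.mrangeRestrict
    ⟨fun _ _ h => hδ A (congrArg Subtype.val h), MonoidHom.mrangeRestrict_surjective _⟩

/-- `δ_A(x)` has underlying element `δ(x)`. [cite: MochizukiFrdI2008, Def. 2.4(iii) p.48] -/
@[simp] theorem coe_imageEquiv (δ : Φ ⟶ Φ) (hδ : ∀ A : Dᵒᵖ, Function.Injective (δ.app A).hom)
    (A : Dᵒᵖ) (x : Φ.obj A) : (imageEquiv δ hδ A x).1 = (δ.app A).hom x :=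
  rfl

/-- `d · Φ` is divisorial (objectwise), being isomorphic to `Φ`. [cite: MochizukiFrdI2008, Def. 2.4(iii) p.48] -/
theorem isDivisorial_imageMonoid (δ : Φ ⟶ Φ) (hδ : ∀ A : Dᵒᵖ, Function.Injective (δ.app A).hom)
    (hΦ : Objectwise (fun M _ => IsDivisorial M) Φ) :
    Objectwise (fun M _ => IsDivisorial M) (imageMonoid δ) :=
  fun A => IsDivisorial.of_mulEquiv (imageEquiv δ hδ (op A)) (hΦ A)

/-- `d · Φ` is a monoid on `D` (Def. 1.1 (ii)): its pull-backs are restrictions of those of `Φ`,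
and `d · Φ(A)` is sharp. [cite: MochizukiFrdI2008, Def. 2.4(iii) p.48] -/
theorem isMonoidOn_imageMonoid (δ : Φ ⟶ Φ) (hδ : ∀ A : Dᵒᵖ, Function.Injective (δ.app A).hom)
    (hΦ : IsMonoidOn Φ) (hΦd : Objectwise (fun M _ => IsDivisorial M) Φ) :
    IsMonoidOn (imageMonoid δ) := by
  have hinj : ∀ {A B : D} (f : B ⟶ A), Function.Injective (pull (imageMonoid δ) f) := by
    intro A B f y y' h
    apply Subtype.ext
    exact (hΦ.isCharInjective f).1 (by
      rw [← coe_pull_imageMonoid, ← coe_pull_imageMonoid, h])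
  refine ⟨fun {A B} f => ⟨hinj f, ?_⟩, fun {A B} f hf => ⟨hinj f, ?_⟩⟩
  · exact associatesMap_injective_of_isSharp (isDivisorial_imageMonoid δ hδ hΦd B).isSharp (hinj f)
  · intro z
    obtain ⟨b, hb⟩ := z.2
    obtain ⟨a, ha⟩ := (hΦ.bijective_of_isFSM f hf).2 b
    refine ⟨⟨(δ.app (op A)).hom a, a, rfl⟩, Subtype.ext ?_⟩
    rw [coe_pull_imageMonoid]
    show pull Φ f ((δ.app (op A)).hom a) = z.1
    rw [← end_app_pull, ha, hb]

namespace PreFrobenioid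

variable {C : Type u'} [Category.{v'} C] {F : C ⥤ ElemFrobenioid Φ}

/-! ### `C(d) → F_{d·Φ}` is a pre-Frobenioid -/

/-- `Base`, `deg_Fr` of an arrow of `C(d)` are those of the underlying arrow of `C`; the
underlying element of its `Div ∈ d · Φ` is its `Div` in `C`. [cite: MochizukiFrdI2008, Prop. 2.5(iii) p.49] -/
theorem coe_div_cd (δ : Φ ⟶ Φ) {X Y : Cd F δ} (ψ : X ⟶ Y) :
    (Div (cdToElem F δ) ψ).1 = Div F ψ.1 := rfl

/-- `C(d)` is totally epimorphic (as `C` is, the inclusion being faithful).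
[cite: MochizukiFrdI2008, Prop. 2.5(iii) p.49] -/
theorem isTotallyEpimorphic_cd (hP : IsPreFrobenioid Φ F) (δ : Φ ⟶ Φ) : IsTotallyEpimorphic (Cd F δ) := by
  refine ⟨fun {X Y} ψ => ⟨fun {Z} g h hgh => ?_⟩⟩
  haveI := hP.isTotallyEpimorphic.epi ψ.1
  apply InducedWideCategory.Hom.ext
  exact (cancel_epi ψ.1).mp (congrArg InducedWideCategory.Hom.hom hgh)

namespace CharacteristicSplitting

variable (hF : IsFrobenioid F) (τ : CharacteristicSplitting F) (hmt : IsOfType (IsMetricallyTrivial F))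
  (haa : IsOfType (IsAutAmple F)) (δ : Φ ⟶ Φ) (hnorm : IsOfType (IsFrobeniusNormalized F))

set_option quotPrecheck false in
/-- The unit-linear Frobenius functor `Ψ : C → C(d)` as a functor (notation local to this file). -/
local notation "𝔊" => (unitLinearFrobeniusData hF τ hmt haa δ hnorm).functor

include hF τ hmt haa δ hnorm

/-- `Ψ` on objects is the identity. [cite: MochizukiFrdI2008, Prop. 2.5(iii) p.49] -/
theorem cdFunctor_obj (A : C) : (𝔊).obj A = ⟨A⟩ := rfl

/-- The underlying arrow of `Ψ(φ)`. [cite: MochizukiFrdI2008, Prop. 2.5(iii) p.49] -/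
theorem cdFunctor_map_hom {A B : C} (φ : A ⟶ B) :
    ((𝔊).map φ).1 = unitLinearMap hF τ hmt haa δ hnorm φ := rfl

/-- `C(d)` is connected (the image of the connected `C` under `Ψ`, which is the identity on objects).
[cite: MochizukiFrdI2008, Prop. 2.5(iii) p.49] -/
theorem isGraphConnected_cd : IsGraphConnected (Cd F δ) := by
  obtain ⟨⟨A⟩, hz⟩ := hF.isPreFrobenioid.isGraphConnected
  exact ⟨⟨(𝔊).obj A⟩, fun X Y => zigzag_obj_of_zigzag 𝔊 (hz X.obj Y.obj)⟩

/-- **`C(d) → F_{d·Φ}` is a pre-Frobenioid** for `δ` injective on each `Φ(A)`.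
[cite: MochizukiFrdI2008, Prop. 2.5(iii) p.49] -/
theorem isPreFrobenioid_cd (hδ : ∀ A : Dᵒᵖ, Function.Injective (δ.app A).hom) :
    IsPreFrobenioid (imageMonoid δ) (cdToElem F δ) where
  isMonoidOn := isMonoidOn_imageMonoid δ hδ hF.isPreFrobenioid.isMonoidOn hF.isPreFrobenioid.isDivisorial
  isDivisorial := isDivisorial_imageMonoid δ hδ hF.isPreFrobenioid.isDivisorial
  isGraphConnected_base := hF.isPreFrobenioid.isGraphConnected_base
  isTotallyEpimorphic_base := hF.isPreFrobenioid.isTotallyEpimorphic_base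
  isGraphConnected := isGraphConnected_cd hF τ hmt haa δ hnorm
  isTotallyEpimorphic := isTotallyEpimorphic_cd hF.isPreFrobenioid δ

/-! ### The dictionary for arrows `Ψ(φ)` -/

/-- `Base(Ψ φ) = Base φ` in `C(d)`. [cite: MochizukiFrdI2008, Prop. 2.5(iii) p.49] -/
theorem base_cdFunctor_map {A B : C} (φ : A ⟶ B) : Base (cdToElem F δ) ((𝔊).map φ) = Base F φ :=
  base_unitLinearMap hF τ hmt haa δ hnorm φ

/-- `deg_Fr(Ψ φ) = deg_Fr φ` in `C(d)`. [cite: MochizukiFrdI2008, Prop. 2.5(iii) p.49] -/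
theorem degFr_cdFunctor_map {A B : C} (φ : A ⟶ B) : degFr (cdToElem F δ) ((𝔊).map φ) = degFr F φ :=
  degFr_unitLinearMap hF τ hmt haa δ hnorm φ

/-- `Div(Ψ φ) = d · Div φ` in `C(d)` (underlying elements). [cite: MochizukiFrdI2008, Prop. 2.5(iii) p.49] -/
theorem coe_div_cdFunctor_map {A B : C} (φ : A ⟶ B) :
    (Div (cdToElem F δ) ((𝔊).map φ)).1 = (δ.app (op (baseObj F A))).hom (Div F φ) :=
  div_unitLinearMap hF τ hmt haa δ hnorm φ

/-- `Div(Ψ φ) = δ_A(Div φ)` in `d · Φ(A)`. [cite: MochizukiFrdI2008, Prop. 2.5(iii) p.49] -/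
theorem div_cdFunctor_map (hδ : ∀ A : Dᵒᵖ, Function.Injective (δ.app A).hom) {A B : C} (φ : A ⟶ B) :
    Div (cdToElem F δ) ((𝔊).map φ) = imageEquiv δ hδ _ (Div F φ) :=
  Subtype.ext (coe_div_cdFunctor_map hF τ hmt haa δ hnorm φ)

/-- Linear: `Ψ φ` iff `φ`. [cite: MochizukiFrdI2008, Prop. 2.5(iii) p.49] -/
theorem isLinear_cdFunctor_map_iff {A B : C} (φ : A ⟶ B) :
    IsLinear (cdToElem F δ) ((𝔊).map φ) ↔ IsLinear F φ := by
  show degFr (cdToElem F δ) ((𝔊).map φ) = 1 ↔ degFr F φ = 1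
  rw [degFr_cdFunctor_map]

/-- Isometry: `Ψ φ` iff `φ` (`δ` injective). [cite: MochizukiFrdI2008, Prop. 2.5(iii) p.49] -/
theorem isIsometry_cdFunctor_map_iff (hδ : ∀ A : Dᵒᵖ, Function.Injective (δ.app A).hom) {A B : C}
    (φ : A ⟶ B) : IsIsometry (cdToElem F δ) ((𝔊).map φ) ↔ IsIsometry F φ := by
  show Div (cdToElem F δ) ((𝔊).map φ) = 1 ↔ Div F φ = 1
  rw [div_cdFunctor_map hF τ hmt haa δ hnorm hδ]
  show imageEquiv δ hδ (op (baseObj F A)) (Div F φ) = 1 ↔ Div F φ = 1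
  rw [map_eq_one_iff _ (imageEquiv δ hδ _).injective]

/-- Base-isomorphism: `Ψ φ` iff `φ`. [cite: MochizukiFrdI2008, Prop. 2.5(iii) p.49] -/
theorem isBaseIso_cdFunctor_map_iff {A B : C} (φ : A ⟶ B) :
    IsBaseIso (cdToElem F δ) ((𝔊).map φ) ↔ IsBaseIso F φ := by
  show IsIso (Base F (unitLinearMap hF τ hmt haa δ hnorm φ)) ↔ IsIso (Base F φ)
  rw [base_unitLinearMap]

/-- Pre-step: `Ψ φ` iff `φ`. [cite: MochizukiFrdI2008, Prop. 2.5(iii) p.49] -/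
theorem isPreStep_cdFunctor_map_iff {A B : C} (φ : A ⟶ B) :
    IsPreStep (cdToElem F δ) ((𝔊).map φ) ↔ IsPreStep F φ :=
  and_congr (isLinear_cdFunctor_map_iff hF τ hmt haa δ hnorm φ) (isBaseIso_cdFunctor_map_iff hF τ hmt haa δ hnorm φ)

/-- Isomorphism: `Ψ φ` iff `φ` (`Ψ` is an equivalence). [cite: MochizukiFrdI2008, Prop. 2.5(iii) p.49] -/
theorem isIso_cdFunctor_map_iff (hδ : ∀ A : Dᵒᵖ, Function.Injective (δ.app A).hom) {A B : C}
    (φ : A ⟶ B) : IsIso ((𝔊).map φ) ↔ IsIso φ := by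
  haveI := unitLinearFrobeniusData_isEquivalence hF τ hmt haa δ hnorm hδ
  exact ⟨fun _ => isIso_of_fully_faithful 𝔊 φ, fun _ => inferInstance⟩

/-- Monomorphism: `Ψ φ` iff `φ` (`Ψ` is fully faithful and the identity on objects).
[cite: MochizukiFrdI2008, Prop. 2.5(iii) p.49] -/
theorem mono_cdFunctor_map_iff (hδ : ∀ A : Dᵒᵖ, Function.Injective (δ.app A).hom) {A B : C}
    (φ : A ⟶ B) : Mono ((𝔊).map φ) ↔ Mono φ := by
  haveI := unitLinearFrobeniusData_isEquivalence hF τ hmt haa δ hnorm hδ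
  constructor
  · intro h
    exact ⟨fun g g' hgg' => (𝔊).map_injective ((cancel_mono ((𝔊).map φ)).mp
      (by rw [← Functor.map_comp, ← Functor.map_comp, hgg']))⟩
  · intro h
    refine ⟨fun {Z'} g g' hgg' => ?_⟩
    obtain ⟨Z, rfl⟩ : ∃ Z : C, (𝔊).obj Z = Z' := ⟨Z'.obj, rfl⟩
    obtain ⟨g₀, rfl⟩ := (𝔊).map_surjective g
    obtain ⟨g₀', rfl⟩ := (𝔊).map_surjective g'
    rw [← Functor.map_comp, ← Functor.map_comp] at hgg'
    rw [(cancel_mono φ).mp ((𝔊).map_injective hgg')]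

/-- Pull-back morphism: `Ψ φ` iff `φ` (the defining bijections correspond under the fully faithful,
`Base`-preserving `Ψ`). [cite: MochizukiFrdI2008, Prop. 2.5(iii) p.49] -/
theorem isPullbackMorphism_cdFunctor_map_iff (hδ : ∀ A : Dᵒᵖ, Function.Injective (δ.app A).hom)
    {A B : C} (φ : A ⟶ B) : IsPullbackMorphism (cdToElem F δ) ((𝔊).map φ) ↔ IsPullbackMorphism F φ := by
  haveI := unitLinearFrobeniusData_isEquivalence hF τ hmt haa δ hnorm hδ
  have hb : ∀ {X Y : C} (γ : X ⟶ Y), Base (cdToElem F δ) ((𝔊).map γ) = Base F γ :=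
    fun γ => base_cdFunctor_map hF τ hmt haa δ hnorm γ
  constructor
  · intro h X
    constructor
    · intro γ₁ γ₂ hγ
      have h1 : γ₁ ≫ φ = γ₂ ≫ φ := congrArg (fun p : PullbackHomData F φ X => p.1.1) hγ
      have h2 : Base F γ₁ = Base F γ₂ := congrArg (fun p : PullbackHomData F φ X => p.1.2) hγ
      apply (𝔊).map_injective
      refine (h ((𝔊).obj X)).1 (a₁ := (𝔊).map γ₁) (a₂ := (𝔊).map γ₂) (Subtype.ext (Prod.ext ?_ ?_))
      · show (𝔊).map γ₁ ≫ (𝔊).map φ = (𝔊).map γ₂ ≫ (𝔊).map φ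
        rw [← Functor.map_comp, ← Functor.map_comp, h1]
      · exact (hb γ₁).trans (h2.trans (hb γ₂).symm)
    · rintro ⟨⟨g, b⟩, hgb⟩
      have hgb' : Base (cdToElem F δ) ((𝔊).map g) = b ≫ Base (cdToElem F δ) ((𝔊).map φ) :=
        (hb g).trans (hgb.trans (congrArg (fun t => b ≫ t) (hb φ).symm))
      obtain ⟨γ', hγ'⟩ := (h ((𝔊).obj X)).2 ⟨((𝔊).map g, b), hgb'⟩
      obtain ⟨γ, rfl⟩ := (𝔊).map_surjective γ'
      have hγ1 : (𝔊).map γ ≫ (𝔊).map φ = (𝔊).map g :=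
        congrArg (fun p : PullbackHomData (cdToElem F δ) ((𝔊).map φ) ((𝔊).obj X) => p.1.1) hγ'
      have hγ2 : Base (cdToElem F δ) ((𝔊).map γ) = b :=
        congrArg (fun p : PullbackHomData (cdToElem F δ) ((𝔊).map φ) ((𝔊).obj X) => p.1.2) hγ'
      refine ⟨γ, Subtype.ext (Prod.ext ?_ ?_)⟩
      · show γ ≫ φ = g
        exact (𝔊).map_injective (by rw [Functor.map_comp, hγ1])
      · exact (hb γ).symm.trans hγ2
  · intro h X'
    obtain ⟨X, rfl⟩ : ∃ X : C, (𝔊).obj X = X' := ⟨X'.obj, rfl⟩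
    constructor
    · intro γ₁' γ₂' hγ
      obtain ⟨γ₁, rfl⟩ := (𝔊).map_surjective γ₁'
      obtain ⟨γ₂, rfl⟩ := (𝔊).map_surjective γ₂'
      have h1 : (𝔊).map γ₁ ≫ (𝔊).map φ = (𝔊).map γ₂ ≫ (𝔊).map φ :=
        congrArg (fun p : PullbackHomData (cdToElem F δ) ((𝔊).map φ) ((𝔊).obj X) => p.1.1) hγ
      have h2 : Base (cdToElem F δ) ((𝔊).map γ₁) = Base (cdToElem F δ) ((𝔊).map γ₂) :=
        congrArg (fun p : PullbackHomData (cdToElem F δ) ((𝔊).map φ) ((𝔊).obj X) => p.1.2) hγ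
      exact congrArg (𝔊).map ((h X).1 (a₁ := γ₁) (a₂ := γ₂) (Subtype.ext (Prod.ext
        ((𝔊).map_injective (by
          show (𝔊).map (γ₁ ≫ φ) = (𝔊).map (γ₂ ≫ φ)
          rw [Functor.map_comp, Functor.map_comp, h1]))
        ((hb γ₁).symm.trans (h2.trans (hb γ₂))))))
    · rintro ⟨⟨g', b⟩, hgb⟩
      obtain ⟨g, rfl⟩ := (𝔊).map_surjective g'
      have hgb' : Base F g = b ≫ Base F φ :=
        (hb g).symm.trans (hgb.trans (congrArg (fun t => b ≫ t) (hb φ)))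
      obtain ⟨γ, hγ⟩ := (h X).2 ⟨(g, b), hgb'⟩
      have hγ1 : γ ≫ φ = g := congrArg (fun p : PullbackHomData F φ X => p.1.1) hγ
      have hγ2 : Base F γ = b := congrArg (fun p : PullbackHomData F φ X => p.1.2) hγ
      refine ⟨(𝔊).map γ, Subtype.ext (Prod.ext ?_ ?_)⟩
      · show (𝔊).map γ ≫ (𝔊).map φ = (𝔊).map g
        rw [← Functor.map_comp, hγ1]
      · exact (hb γ).trans hγ2

/-- Co-angular: `Ψ φ` iff `φ` (factorisations in `C(d)` are images of factorisations in `C`, with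
the classes of arrows preserved and reflected). [cite: MochizukiFrdI2008, Prop. 2.5(iii) p.49] -/
theorem isCoAngular_cdFunctor_map_iff (hδ : ∀ A : Dᵒᵖ, Function.Injective (δ.app A).hom)
    {A B : C} (φ : A ⟶ B) : IsCoAngular (cdToElem F δ) ((𝔊).map φ) ↔ IsCoAngular F φ := by
  haveI := unitLinearFrobeniusData_isEquivalence hF τ hmt haa δ hnorm hδ
  constructor
  · intro h X Y γ β α hfac hα hβ₁ hβ₂ hbi
    have := h ((𝔊).map γ) ((𝔊).map β) ((𝔊).map α)
      (by rw [← Functor.map_comp, ← Functor.map_comp, hfac])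
      ((isLinear_cdFunctor_map_iff hF τ hmt haa δ hnorm α).mpr hα)
      ((isIsometry_cdFunctor_map_iff hF τ hmt haa δ hnorm hδ β).mpr hβ₁)
      ((isPreStep_cdFunctor_map_iff hF τ hmt haa δ hnorm β).mpr hβ₂)
      (hbi.imp (isBaseIso_cdFunctor_map_iff hF τ hmt haa δ hnorm α).mpr
        (isBaseIso_cdFunctor_map_iff hF τ hmt haa δ hnorm γ).mpr)
    exact (isIso_cdFunctor_map_iff hF τ hmt haa δ hnorm hδ β).mp this
  · intro h X' Y' γ' β' α' hfac hα hβ₁ hβ₂ hbi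
    obtain ⟨X, rfl⟩ : ∃ X : C, (𝔊).obj X = X' := ⟨X'.obj, rfl⟩
    obtain ⟨Y, rfl⟩ : ∃ Y : C, (𝔊).obj Y = Y' := ⟨Y'.obj, rfl⟩
    obtain ⟨γ, rfl⟩ := (𝔊).map_surjective γ'
    obtain ⟨β, rfl⟩ := (𝔊).map_surjective β'
    obtain ⟨α, rfl⟩ := (𝔊).map_surjective α'
    have hfac' : γ ≫ β ≫ α = φ :=
      (𝔊).map_injective (by rw [Functor.map_comp, Functor.map_comp, hfac])
    have := h γ β α hfac' ((isLinear_cdFunctor_map_iff hF τ hmt haa δ hnorm α).mp hα)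
      ((isIsometry_cdFunctor_map_iff hF τ hmt haa δ hnorm hδ β).mp hβ₁)
      ((isPreStep_cdFunctor_map_iff hF τ hmt haa δ hnorm β).mp hβ₂)
      (hbi.imp (isBaseIso_cdFunctor_map_iff hF τ hmt haa δ hnorm α).mp
        (isBaseIso_cdFunctor_map_iff hF τ hmt haa δ hnorm γ).mp)
    exact (isIso_cdFunctor_map_iff hF τ hmt haa δ hnorm hδ β).mpr this

/-- Co-angular pre-step: `Ψ φ` iff `φ`. [cite: MochizukiFrdI2008, Prop. 2.5(iii) p.49] -/
theorem isCoAngularPreStep_cdFunctor_map_iff (hδ : ∀ A : Dᵒᵖ, Function.Injective (δ.app A).hom)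
    {A B : C} (φ : A ⟶ B) :
    IsCoAngularPreStep (cdToElem F δ) ((𝔊).map φ) ↔ IsCoAngularPreStep F φ :=
  and_congr (isCoAngular_cdFunctor_map_iff hF τ hmt haa δ hnorm hδ φ)
    (isPreStep_cdFunctor_map_iff hF τ hmt haa δ hnorm φ)

/-- Of Frobenius type: `Ψ φ` iff `φ`. [cite: MochizukiFrdI2008, Prop. 2.5(iii) p.49] -/
theorem isFrobeniusType_cdFunctor_map_iff (hδ : ∀ A : Dᵒᵖ, Function.Injective (δ.app A).hom)
    {A B : C} (φ : A ⟶ B) :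
    IsFrobeniusType (cdToElem F δ) ((𝔊).map φ) ↔ IsFrobeniusType F φ :=
  and_congr (and_congr (isCoAngular_cdFunctor_map_iff hF τ hmt haa δ hnorm hδ φ)
    (isIsometry_cdFunctor_map_iff hF τ hmt haa δ hnorm hδ φ)) (isBaseIso_cdFunctor_map_iff hF τ hmt haa δ hnorm φ)

end CharacteristicSplitting

end PreFrobenioid

end Literature.AlgebraicGeometry.Frobenioids
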